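import Mathlib
import HarnessLib
import Literature.MathematicalPhysics.QuantumFieldTheory.ConstructiveQFTWave0
import Literature.MathematicalPhysics.QuantumFieldTheory.LatticeGaugeProofs
import Summits.Ventures.LatticeQCDFlow.Scaling.PlaquetteIndependence2D
import Summits.Ventures.LatticeQCDFlow.Scaling.WilsonPairCovarianceTwoDim
import Summits.Ventures.LatticeQCDFlow.Scaling.PlaquettePatchDecorrelationTwoDim

/-!
# LatticeQCDFlow / Scaling — two dimensions, every compact gauge group: the Wilson plaquette field is asymptotically an i.i.d. field (finite-dimensional distributions, explicit two-sided ratio)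

HONEST FRAMING: exact (Metropolis-corrected) sampling algorithms for lattice gauge theory; figures of merit are
autocorrelation/cost numbers at stated couplings and volumes; no continuum-physics claim.

Venture `LatticeQCDFlow` (cell pub-lqcd), topic `Scaling`, FANOUT row 30 (lean-1) — OUR WORK, the NORMALISED form of the
patch expansion `Scaling/PlaquettePatchDecorrelationTwoDim.lean` (`patch_lintegral_upper/lower`) for the Wilson weight
`w(g) = e^{−β(N − Re tr ρ(g))}` of a CONTINUOUS representation `ρ` of a compact second-countable `G` at ANY real `β`:

* **`wilson_patch_sandwich`** — there are ratios `r_{ρ,β}(k, L)` with `0 < r ≤ 1` whenever `k + 2 ≤ L²` and `r(k, ·) → 1` for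
  every `k`, such that for every `L ≥ 2`, every patch `P` of plaquettes of `(ℤ/L)²` with `#P + 2 ≤ L²` and every family of
  measurable `0 ≤ φ_x ≤ A_x` (`x ∈ P`):
  `r(#P, L) · ∏_{x∈P} ν_β(φ_x) ≤ ∫ ∏_{x∈P} φ_x(U_x) dμ_{β,L} ≤ r(#P, L)⁻¹ · ∏_{x∈P} ν_β(φ_x)`,
  where `ν_β(φ) = (∫ φ·w dHaar)/(∫ w dHaar)` is the mean of `φ` under the ONE-PLAQUETTE law `w dHaar/z` — every cylinder
  expectation of the two-dimensional Wilson plaquette field is within a factor `r^{±1} → 1` of its i.i.d. value, uniformly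
  in the position of the patch: convergence of the finite-dimensional distributions to the product of one-plaquette laws,
  for every compact gauge group (the pair case, with covariances, is `Scaling/WilsonPairCovarianceTwoDim.lean`).

`r(k, L) = (z^{L²−k} − y^{L²−k})/(z^{L²−k} + s·y^{L²−k−1})` with the file's `c = e^{−|β|(N+M)} ≤ w ≤ s = e^{|β|(N+M)}`,
`y = m(w) − c`, `z = m(w)` (so `1 − r = O((y/z)^{L²−k−1})` by inspection; the Lean statement records `r(k, ·) → 1`).
(`G : Type`.)  Literature grade: known (two-dimensional lattice gauge theory is solvable; Migdal 1975, Gross–Witten 1980);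
new = character-free, kernel-checked, every compact group.  Elementary given the tree; nothing here is cited as a fact;
no `def`, no `sorry`.
-/

noncomputable section

namespace Summit.Ventures.LatticeQCDFlow.Theory2.Lattice.TwoDim

open MeasureTheory Filter Topology Literature.MathematicalPhysics.QuantumFieldTheory
open scoped ENNReal

variable {N : ℕ} {G : Type} [Group G] [TopologicalSpace G] [IsTopologicalGroup G] [CompactSpace G]
  [SecondCountableTopology G] [MeasurableSpace G] [BorelSpace G] (ρ : G →* Matrix (Fin N) (Fin N) ℂ)

/-- The patch ratio `(z^{L²−k} − y^{L²−k})/(z^{L²−k} + s·y^{L²−k−1}) → 1` for `0 ≤ y < z`, `0 ≤ s`. [folklore] -/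
theorem patchRatio_tendsto_one {z y s : ℝ} (hy0 : 0 ≤ y) (hyz : y < z) (hs : 0 ≤ s) (k : ℕ) :
    Tendsto (fun L : ℕ => (z ^ (L ^ 2 - k) - y ^ (L ^ 2 - k)) / (z ^ (L ^ 2 - k) + s * y ^ (L ^ 2 - k - 1)))
      atTop (𝓝 1) := by
  have hz : 0 < z := lt_of_le_of_lt hy0 hyz
  set q : ℝ := y / z with hq
  have hq0 : 0 ≤ q := div_nonneg hy0 hz.le
  have hq1 : q < 1 := (div_lt_one hz).mpr hyz
  have hpowk : Tendsto (fun L : ℕ => q ^ (L ^ 2 - k)) atTop (𝓝 0) :=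
    (tendsto_pow_atTop_nhds_zero_of_lt_one hq0 hq1).comp (tendsto_sq_sub_atTop k)
  have hpowk1 : Tendsto (fun L : ℕ => q ^ (L ^ 2 - k - 1)) atTop (𝓝 0) := by
    have h := (tendsto_pow_atTop_nhds_zero_of_lt_one hq0 hq1).comp (tendsto_sq_sub_atTop (k + 1))
    refine h.congr fun L => ?_
    simp only [Function.comp_apply, Nat.sub_sub]
  have hlim : Tendsto (fun L : ℕ => (1 - q ^ (L ^ 2 - k)) / (1 + s / z * q ^ (L ^ 2 - k - 1))) atTop (𝓝 1) := by
    have h1 : Tendsto (fun L : ℕ => (1 : ℝ) - q ^ (L ^ 2 - k)) atTop (𝓝 (1 - 0)) := hpowk.const_sub 1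
    have h2 : Tendsto (fun L : ℕ => (1 : ℝ) + s / z * q ^ (L ^ 2 - k - 1)) atTop (𝓝 (1 + s / z * 0)) :=
      (hpowk1.const_mul (s / z)).const_add 1
    have h := h1.div h2 (by norm_num : (1 : ℝ) + s / z * 0 ≠ 0)
    rw [sub_zero, mul_zero, add_zero, div_one] at h
    exact h
  refine hlim.congr' ?_
  filter_upwards [eventually_ge_atTop (k + 2)] with L hL
  obtain ⟨m, hm⟩ : ∃ m, L ^ 2 - k - 1 = m := ⟨_, rfl⟩
  have hn : L ^ 2 - k = m + 1 := by
    have : L ≤ L ^ 2 := by nlinarith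
    omega
  have hzn : (0 : ℝ) < z ^ m := pow_pos hz _
  rw [hm, hn, hq, div_pow, div_pow, pow_succ z, pow_succ y]
  field_simp

set_option maxHeartbeats 400000 in
/-- **THE WILSON PLAQUETTE FIELD OF `(ℤ/L)²` IS ASYMPTOTICALLY I.I.D. (finite-dimensional distributions, two-sided
ratio), every compact gauge group, every continuous representation, every real coupling.** [folklore] -/
theorem wilson_patch_sandwich (hρ : Continuous ρ) (β : ℝ) :
    ∃ r : ℕ → ℕ → ℝ, (∀ k L, k + 2 ≤ L ^ 2 → 0 < r k L ∧ r k L ≤ 1) ∧ (∀ k, Tendsto (r k) atTop (𝓝 1)) ∧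
      ∀ (L : ℕ) [NeZero L], 2 ≤ L → ∀ P : Finset (Site 2 L), P.card + 2 ≤ L ^ 2 →
        ∀ φ : Site 2 L → G → ℝ, (∀ x, Measurable (φ x)) → ∀ A : Site 2 L → ℝ,
          (∀ x g, 0 ≤ φ x g) → (∀ x g, φ x g ≤ A x) →
          r P.card L * ∏ x ∈ P,
              ((∫⁻ g, ENNReal.ofReal (φ x g) * ENNReal.ofReal (Real.exp (-(β * ((N : ℝ) - (ρ g).trace.re))))
                  ∂(haarProbability G)).toReal /
                (∫⁻ g, ENNReal.ofReal (Real.exp (-(β * ((N : ℝ) - (ρ g).trace.re)))) ∂(haarProbability G)).toReal) ≤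
            ∫ U, ∏ x ∈ P, φ x (plaquetteHolonomy U x 0 1) ∂(wilsonMeasure (d := 2) (L := L) ρ β) ∧
          ∫ U, ∏ x ∈ P, φ x (plaquetteHolonomy U x 0 1) ∂(wilsonMeasure (d := 2) (L := L) ρ β) ≤
            (r P.card L)⁻¹ * ∏ x ∈ P,
              ((∫⁻ g, ENNReal.ofReal (φ x g) * ENNReal.ofReal (Real.exp (-(β * ((N : ℝ) - (ρ g).trace.re))))
                  ∂(haarProbability G)).toReal /
                (∫⁻ g, ENNReal.ofReal (Real.exp (-(β * ((N : ℝ) - (ρ g).trace.re)))) ∂(haarProbability G)).toReal) := by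
  classical
  obtain ⟨M, hM0, hM⟩ := wilson_oneWeight_bounds ρ hρ β
  set K : ℝ := |β| * ((N : ℝ) + M) with hK
  set cr : ℝ := Real.exp (-K) with hcr
  set sr : ℝ := Real.exp K with hsr
  have hcr0 : 0 < cr := Real.exp_pos _
  have hsr0 : 0 < sr := Real.exp_pos _
  set w : G → ℝ≥0∞ := fun g => ENNReal.ofReal (Real.exp (-(β * ((N : ℝ) - (ρ g).trace.re)))) with hw
  set c : ℝ≥0∞ := ENNReal.ofReal cr with hc
  set sE : ℝ≥0∞ := ENNReal.ofReal sr with hsE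
  have hwm : Measurable w := measurable_oneWeight ρ hρ β
  have hcw : ∀ g, c ≤ w g := fun g => ENNReal.ofReal_le_ofReal (hM g).1
  have hws : ∀ g, w g ≤ sE := fun g => ENNReal.ofReal_le_ofReal (hM g).2
  set v : G → ℝ≥0∞ := fun g => w g - c with hv
  have hvm : Measurable v := hwm.sub measurable_const
  have hcv : ∀ g, c + v g = w g := fun g => add_tsub_cancel_of_le (hcw g)
  have hvs : ∀ g, v g ≤ sE := fun g => tsub_le_self.trans (hws g)
  have hct : c ≠ ⊤ := ENNReal.ofReal_ne_top
  have hsEt : sE ≠ ⊤ := ENNReal.ofReal_ne_top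
  have hcvm : Measurable fun g => c + v g := measurable_const.add hvm
  set y : ℝ≥0∞ := ∫⁻ g, v g ∂(haarProbability G) with hy
  have hyle : y ≤ sE := by
    calc y ≤ ∫⁻ _, sE ∂(haarProbability G) := lintegral_mono fun g => hvs g
      _ = sE := by rw [lintegral_const, measure_univ, mul_one]
  have hyt : y ≠ ⊤ := ne_top_of_le_ne_top hsEt hyle
  have hcy : ∫⁻ g, c + v g ∂(haarProbability G) = c + y := by
    rw [lintegral_add_right _ hvm, lintegral_const, measure_univ, mul_one]
  have hzw : ∫⁻ g, w g ∂(haarProbability G) = c + y := by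
    rw [← hcy]; exact lintegral_congr fun g => (hcv g).symm
  set yr : ℝ := y.toReal with hyr
  have hyr0 : 0 ≤ yr := ENNReal.toReal_nonneg
  set zr : ℝ := cr + yr with hzr
  have hzr0 : 0 < zr := by linarith
  have hyz : yr < zr := by linarith
  have hcyt : c + y ≠ ⊤ := ENNReal.add_ne_top.mpr ⟨hct, hyt⟩
  have hcyr : (c + y).toReal = zr := by rw [ENNReal.toReal_add hct hyt, hc, ENNReal.toReal_ofReal hcr0.le]
  have hsEr : sE.toReal = sr := ENNReal.toReal_ofReal hsr0.le
  have hzwr : (∫⁻ g, w g ∂(haarProbability G)).toReal = zr := by rw [hzw, hcyr]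
  have hzexp : (∫⁻ g, ENNReal.ofReal (Real.exp (-(β * ((N : ℝ) - (ρ g).trace.re)))) ∂(haarProbability G)).toReal =
      zr := hzwr
  -- the ratio
  set r : ℕ → ℕ → ℝ := fun k L =>
    (zr ^ (L ^ 2 - k) - yr ^ (L ^ 2 - k)) / (zr ^ (L ^ 2 - k) + sr * yr ^ (L ^ 2 - k - 1)) with hr
  have hrpos : ∀ k L, k + 2 ≤ L ^ 2 →
      0 < zr ^ (L ^ 2 - k) - yr ^ (L ^ 2 - k) ∧ 0 < zr ^ (L ^ 2 - k) + sr * yr ^ (L ^ 2 - k - 1) := by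
    intro k L hkL
    have hn : L ^ 2 - k ≠ 0 := by omega
    have hlt : yr ^ (L ^ 2 - k) < zr ^ (L ^ 2 - k) := pow_lt_pow_left₀ hyz hyr0 hn
    exact ⟨by linarith, by positivity⟩
  refine ⟨r, fun k L hkL => ?_, fun k => patchRatio_tendsto_one hyr0 hyz hsr0.le k,
    fun L _ hL P hP φ hφm A hφ0 hφA => ?_⟩
  · obtain ⟨hDlo, hDup⟩ := hrpos k L hkL
    refine ⟨div_pos hDlo hDup, (div_le_one hDup).mpr ?_⟩
    nlinarith [pow_nonneg hyr0 (L ^ 2 - k), mul_nonneg hsr0.le (pow_nonneg hyr0 (L ^ 2 - k - 1))]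
  -- MAIN
  obtain ⟨hDlo, hDup⟩ := hrpos P.card L hP
  set Dlo : ℝ := zr ^ (L ^ 2 - P.card) - yr ^ (L ^ 2 - P.card) with hDlodef
  set Dup : ℝ := zr ^ (L ^ 2 - P.card) + sr * yr ^ (L ^ 2 - P.card - 1) with hDupdef
  have hrL : r P.card L = Dlo / Dup := rfl
  set μ := wilsonMeasure (d := 2) (L := L) ρ β with hμ
  haveI : IsProbabilityMeasure μ := isProbabilityMeasure_wilsonMeasure (d := 2) (L := L) ρ hρ β
  set π : Measure (GaugeConfig 2 L G) := Measure.pi fun _ : Edge 2 L => haarProbability G with hπ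
  have hdensprod : ∀ U : GaugeConfig 2 L G, ENNReal.ofReal (Real.exp (-β * wilsonAction ρ U)) =
      ∏ x, (c + v (plaquetteHolonomy U x 0 1)) := fun U => by
    rw [weight_eq_prod_two ρ β U]
    exact Finset.prod_congr rfl fun x _ => (hcv _).symm
  have hdens : Measurable fun U : GaugeConfig 2 L G => ENNReal.ofReal (Real.exp (-β * wilsonAction ρ U)) := by
    rw [funext hdensprod]
    exact Finset.measurable_prod _ fun x _ => hcvm.comp (measurable_plaquetteHolonomy x)
  have hlin : ∀ {F : GaugeConfig 2 L G → ℝ≥0∞}, Measurable F →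
      ∫⁻ U, F U ∂μ = (partitionFunction (d := 2) (L := L) ρ β)⁻¹ *
        ∫⁻ U, F U * ∏ x, (c + v (plaquetteHolonomy U x 0 1)) ∂π := by
    intro F hF
    rw [hμ]
    unfold wilsonMeasure
    rw [lintegral_smul_measure]
    congr 1
    unfold wilsonWeight
    rw [lintegral_withDensity_eq_lintegral_mul _ hdens hF]
    refine lintegral_congr fun U => ?_
    rw [Pi.mul_apply, hdensprod U, mul_comm]
  have hZ : partitionFunction (d := 2) (L := L) ρ β =
      ∫⁻ U, ∏ x, (c + v (plaquetteHolonomy U x 0 1)) ∂π := by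
    unfold partitionFunction wilsonWeight
    rw [withDensity_apply _ MeasurableSet.univ, Measure.restrict_univ]
    exact lintegral_congr fun U => hdensprod U
  set Z := partitionFunction (d := 2) (L := L) ρ β with hZdef
  -- `Z` bounds from the empty patch
  obtain ⟨hZL, hZU⟩ := lintegral_prod_weight_two_sandwich (L := L) hL c hvm hvs
  rw [← hπ, ← hZ] at hZL hZU
  have hAU : (c + y) ^ (L ^ 2) + sE * y ^ (L ^ 2 - 1) ≠ ⊤ :=
    ENNReal.add_ne_top.mpr ⟨ENNReal.pow_ne_top hcyt, ENNReal.mul_ne_top hsEt (ENNReal.pow_ne_top hyt)⟩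
  have hZt : Z ≠ ⊤ := ne_top_of_le_ne_top hAU hZU
  set Zr : ℝ := Z.toReal with hZrdef
  have hZr_le : Zr ≤ zr ^ (L ^ 2) + sr * yr ^ (L ^ 2 - 1) := by
    have h := ENNReal.toReal_mono hAU hZU
    rwa [ENNReal.toReal_add (ENNReal.pow_ne_top hcyt) (ENNReal.mul_ne_top hsEt (ENNReal.pow_ne_top hyt)),
      ENNReal.toReal_pow, ENNReal.toReal_mul, ENNReal.toReal_pow, hcyr, hsEr] at h
  have hZr_ge : zr ^ (L ^ 2) ≤ Zr + yr ^ (L ^ 2) := by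
    have h := ENNReal.toReal_mono (ENNReal.add_ne_top.mpr ⟨hZt, ENNReal.pow_ne_top hyt⟩) hZL
    rwa [ENNReal.toReal_add hZt (ENNReal.pow_ne_top hyt), ENNReal.toReal_pow, ENNReal.toReal_pow, hcyr] at h
  -- the patch bounds
  set Φ : Site 2 L → G → ℝ≥0∞ := fun x g => ENNReal.ofReal (φ x g) with hΦ
  have hΦm : ∀ x, Measurable (Φ x) := fun x => (hφm x).ennreal_ofReal
  have hU := patch_lintegral_upper hL P hP c hvm hΦm hvs
  have hLo := patch_lintegral_lower hL P c hvm hΦm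
  rw [← hπ] at hU hLo
  have haE_le : ∀ x, ∫⁻ g, Φ x g * (c + v g) ∂(haarProbability G) ≤ ENNReal.ofReal (A x) * (c + y) := fun x => by
    rw [← hcy, ← lintegral_const_mul _ hcvm]
    exact lintegral_mono fun g => mul_le_mul_left (ENNReal.ofReal_le_ofReal (hφA x g)) _
  set AE : ℝ≥0∞ := ∏ x ∈ P, ∫⁻ g, Φ x g * (c + v g) ∂(haarProbability G) with hAE
  have hprodt : AE ≠ ⊤ := ENNReal.prod_ne_top fun x _ =>
    ne_top_of_le_ne_top (ENNReal.mul_ne_top ENNReal.ofReal_ne_top hcyt) (haE_le x)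
  set ar : ℝ := AE.toReal with har
  have har0 : 0 ≤ ar := ENNReal.toReal_nonneg
  -- the real integral is `Nr / Zr`
  set NE := ∫⁻ U, (∏ x ∈ P, Φ x (plaquetteHolonomy U x 0 1)) *
      ∏ x, (c + v (plaquetteHolonomy U x 0 1)) ∂π with hNE
  have hUupt : (c + y) ^ (L ^ 2 - P.card) + sE * y ^ (L ^ 2 - P.card - 1) ≠ ⊤ :=
    ENNReal.add_ne_top.mpr ⟨ENNReal.pow_ne_top hcyt, ENNReal.mul_ne_top hsEt (ENNReal.pow_ne_top hyt)⟩
  have hNEt : NE ≠ ⊤ := ne_top_of_le_ne_top (ENNReal.mul_ne_top hprodt hUupt) hU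
  set Nr := NE.toReal with hNr
  have hNr0 : 0 ≤ Nr := ENNReal.toReal_nonneg
  have hNr_le : Nr ≤ ar * Dup := by
    have h := ENNReal.toReal_mono (ENNReal.mul_ne_top hprodt hUupt) hU
    rwa [ENNReal.toReal_mul, ENNReal.toReal_add (ENNReal.pow_ne_top hcyt)
      (ENNReal.mul_ne_top hsEt (ENNReal.pow_ne_top hyt)), ENNReal.toReal_pow, ENNReal.toReal_mul,
      ENNReal.toReal_pow, hcyr, hsEr] at h
  have hNr_ge' : ar * zr ^ (L ^ 2 - P.card) ≤ Nr + ar * yr ^ (L ^ 2 - P.card) := by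
    have hfin : NE + AE * y ^ (L ^ 2 - P.card) ≠ ⊤ :=
      ENNReal.add_ne_top.mpr ⟨hNEt, ENNReal.mul_ne_top hprodt (ENNReal.pow_ne_top hyt)⟩
    have h := ENNReal.toReal_mono hfin hLo
    rwa [ENNReal.toReal_add hNEt (ENNReal.mul_ne_top hprodt (ENNReal.pow_ne_top hyt)), ENNReal.toReal_mul,
      ENNReal.toReal_mul, ENNReal.toReal_pow, ENNReal.toReal_pow, hcyr] at h
  have hNr_ge : ar * Dlo ≤ Nr := by rw [hDlodef]; nlinarith
  have hmeasF : Measurable fun U : GaugeConfig 2 L G => ∏ x ∈ P, Φ x (plaquetteHolonomy U x 0 1) :=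
    Finset.measurable_prod _ fun x _ => (hΦm x).comp (measurable_plaquetteHolonomy x)
  have hE : ∫ U, ∏ x ∈ P, φ x (plaquetteHolonomy U x 0 1) ∂μ = Nr / Zr := by
    rw [integral_eq_lintegral_of_nonneg_ae (ae_of_all _ fun U => Finset.prod_nonneg fun x _ => hφ0 x _)
      ((Finset.measurable_prod _ fun x _ =>
        (hφm x).comp (measurable_plaquetteHolonomy x)).aestronglyMeasurable)]
    have h1 : ∫⁻ U, ENNReal.ofReal (∏ x ∈ P, φ x (plaquetteHolonomy U x 0 1)) ∂μ =
        ∫⁻ U, ∏ x ∈ P, Φ x (plaquetteHolonomy U x 0 1) ∂μ :=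
      lintegral_congr fun U => by rw [ENNReal.ofReal_prod_of_nonneg fun x _ => hφ0 x _]
    rw [h1, hlin hmeasF, ← hNE, ENNReal.toReal_mul, ENNReal.toReal_inv, ← hZrdef, ← hNr, div_eq_inv_mul]
  -- the product of one-plaquette means
  have hν : ∏ x ∈ P, ((∫⁻ g, ENNReal.ofReal (φ x g) * ENNReal.ofReal (Real.exp (-(β * ((N : ℝ) - (ρ g).trace.re))))
        ∂(haarProbability G)).toReal /
      (∫⁻ g, ENNReal.ofReal (Real.exp (-(β * ((N : ℝ) - (ρ g).trace.re)))) ∂(haarProbability G)).toReal) =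
      ar / zr ^ P.card := by
    have h1 : ∀ x, (∫⁻ g, ENNReal.ofReal (φ x g) * ENNReal.ofReal (Real.exp (-(β * ((N : ℝ) - (ρ g).trace.re))))
        ∂(haarProbability G)) = ∫⁻ g, Φ x g * (c + v g) ∂(haarProbability G) := fun x =>
      lintegral_congr fun g => by simp only [hΦ, hw, hcv]
    simp only [h1]
    rw [Finset.prod_div_distrib, Finset.prod_const, har, hAE, ENNReal.toReal_prod, hzexp]
  have hZr_lo : zr ^ (L ^ 2) - yr ^ (L ^ 2) ≤ Zr := by linarith
  -- `z^{L²} r-bounds`: relate the `Z` window to the patch window through `z^{#P}`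
  have hk : L ^ 2 = P.card + (L ^ 2 - P.card) := by omega
  have hzsplit : zr ^ (L ^ 2) = zr ^ P.card * zr ^ (L ^ 2 - P.card) := by rw [← pow_add, ← hk]
  have hysplit : yr ^ (L ^ 2) ≤ zr ^ P.card * yr ^ (L ^ 2 - P.card) := by
    calc yr ^ (L ^ 2) = yr ^ P.card * yr ^ (L ^ 2 - P.card) := by rw [← pow_add, ← hk]
      _ ≤ zr ^ P.card * yr ^ (L ^ 2 - P.card) :=
          mul_le_mul_of_nonneg_right (pow_le_pow_left₀ hyr0 hyz.le _) (pow_nonneg hyr0 _)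
  have hysplit' : sr * yr ^ (L ^ 2 - 1) ≤ zr ^ P.card * (sr * yr ^ (L ^ 2 - P.card - 1)) := by
    have hk1 : L ^ 2 - 1 = P.card + (L ^ 2 - P.card - 1) := by omega
    calc sr * yr ^ (L ^ 2 - 1) = sr * (yr ^ P.card * yr ^ (L ^ 2 - P.card - 1)) := by rw [← pow_add, ← hk1]
      _ ≤ sr * (zr ^ P.card * yr ^ (L ^ 2 - P.card - 1)) :=
          mul_le_mul_of_nonneg_left (mul_le_mul_of_nonneg_right (pow_le_pow_left₀ hyr0 hyz.le _)
            (pow_nonneg hyr0 _)) hsr0.le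
      _ = _ := by ring
  have hzk : (0 : ℝ) < zr ^ P.card := pow_pos hzr0 _
  have hZr_loP : zr ^ P.card * Dlo ≤ Zr := by rw [hDlodef]; nlinarith
  have hZr_upP : Zr ≤ zr ^ P.card * Dup := by rw [hDupdef]; nlinarith
  have hZr0 : 0 < Zr := lt_of_lt_of_le (by positivity) hZr_loP
  have key1 : Dlo / Dup * (ar / zr ^ P.card) ≤ Nr / Zr := by
    rw [div_mul_div_comm, mul_comm Dlo ar, mul_comm Dup (zr ^ P.card)]
    exact div_le_div₀ hNr0 hNr_ge hZr0 hZr_upP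
  have key2 : Nr / Zr ≤ (Dlo / Dup)⁻¹ * (ar / zr ^ P.card) := by
    rw [inv_div, div_mul_div_comm, mul_comm Dup ar, mul_comm Dlo (zr ^ P.card)]
    exact div_le_div₀ (mul_nonneg har0 hDup.le) hNr_le (mul_pos hzk hDlo) hZr_loP
  rw [hν, hE, hrL]
  exact ⟨key1, key2⟩

end Summit.Ventures.LatticeQCDFlow.Theory2.Lattice.TwoDim

end
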